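import Mathlib
import HarnessLib
import Summits.Ventures.LatticeQCDFlow.Scoring.KernelAdmissibleClass
import Summits.Ventures.LatticeQCDFlow.Scoring.AdjointKernelAutocovariance
import Summits.Ventures.LatticeQCDFlow.Exactness.OrderedSweepComparison

/-!
# Two reversible block updates as KERNELS: the ordered sweep `κ₂ ∘ₖ κ₁` never scores worse than two random-scan steps `R ∘ₖ R`, `R = ½(κ₁ + κ₂)`, nor than the random-order sweep — every bounded observable, any state space

HONEST FRAMING: exact (Metropolis-corrected) sampling algorithms for lattice gauge theory;
figures of merit are autocorrelation/cost numbers at stated couplings and volumes; no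
continuum-physics claim.

Venture `LatticeQCDFlow` (cell pub-lqcd), topic `Scoring`; FANOUT row 8 (`s0-cpn-nemc`, GEN-24).
NEW WORK of the cell: the kernel-level form of `Exactness/OrderedSweepComparison` (row 2's `RevOp`
format) through the bridge `Scoring/KernelAdmissibleClass` and `kop_mixtureKernel`
(`Scoring/AdjointKernelAutocovariance`; `mixtureKernel` of `Scaling/SimulatedTemperingWithinLevel`).
Nothing is cited as a fact.  Printed counterpart NAMED ONLY: Maire–Douc–Olsson 2014 (two-component
deterministic-scan Gibbs beats random scan in asymptotic variance).

## Content (`π` a probability law; `κ₁, κ₂` `π`-reversible Markov kernels; `g` bounded measurable;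
## `0 ≤ r < 1`; `t : unitInterval` with `(t : ℝ) = ½`; `R = mixtureKernel t κ₁ κ₂`)

* bookkeeping on bounded measurable `f`: `kop_comp_bddMeas` (`kop (κ₂ ∘ₖ κ₁) f = kop κ₁ (kop κ₂ f)`),
  `kop_mixture_half_bddMeas` (`kop R f = ½(kop κ₁ f + kop κ₂ f)`);
* **`abelSum_autocov_orderedSweep_le_randomScanTwo`** —
  `Σ_k autocov (κ₂ ∘ₖ κ₁) π g k rᵏ ≤ Σ_k autocov (R ∘ₖ R) π g k rᵏ` (equal cost: two block updates per step);
  **`tauInt_orderedSweep_le_randomScanTwo`** — `τ_int(g; κ₂ ∘ₖ κ₁) ≤ τ_int(g; R ∘ₖ R)` under summability;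
* **`abelSum_autocov_orderedSweep_le_randomOrder`** — the Abel-form comparison against the random-ORDER
  sweep `mixtureKernel t (κ₂ ∘ₖ κ₁) (κ₁ ∘ₖ κ₂)`.

Reading: even/odd (checkerboard) heat-bath or Metropolis half-sweeps, links-then-sites of `cpn_2d`,
momentum refresh / trajectory pairs — whenever a sampler alternates two reversible blocks, the fixed
alternation is never worse than coin-flipping the block or the order, for every observable.  NOT
CLAIMED: three or more blocks against random scan; unbounded observables; any number of ours.
-/

noncomputable section

namespace Summit.Ventures.LatticeQCDFlow.Scoring

open MeasureTheory ProbabilityTheory Filter Finset Summit.Ventures.LatticeQCDFlow.Exactness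
  Summit.Ventures.LatticeQCDFlow.Scaling
open scoped ENNReal

variable {Ω : Type*} [MeasurableSpace Ω]

section TwoBlocks

variable {κ₁ κ₂ : Kernel Ω Ω} [IsMarkovKernel κ₁] [IsMarkovKernel κ₂] {π : Measure Ω}
  [IsProbabilityMeasure π]

/-- `kop (κ₂ ∘ₖ κ₁) f = kop κ₁ (kop κ₂ f)` pointwise on the class (Chapman–Kolmogorov on observables). -/
theorem kop_comp_bddMeas : ∀ ⦃f : Ω → ℝ⦄, (Measurable f ∧ ∃ B, ∀ x, |f x| ≤ B) →
    ∀ x, kop (κ₂ ∘ₖ κ₁) f x = kop κ₁ (kop κ₂ f) x := by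
  rintro f ⟨hf, B, hB⟩ x
  rw [kop_comp κ₁ κ₂ hf hB]

/-- `kop (mixtureKernel t κ₁ κ₂) f = ½(kop κ₁ f + kop κ₂ f)` pointwise on the class, `(t : ℝ) = ½`. -/
theorem kop_mixture_half_bddMeas (t : unitInterval) (ht : (t : ℝ) = 1 / 2) :
    ∀ ⦃f : Ω → ℝ⦄, (Measurable f ∧ ∃ B, ∀ x, |f x| ≤ B) →
      ∀ x, kop (mixtureKernel t κ₁ κ₂) f x = (kop κ₁ f x + kop κ₂ f x) / 2 := by
  rintro f ⟨hf, B, hB⟩ x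
  rw [kop_mixtureKernel t hf hB x, ht]
  ring

/-- **ORDERED TWO-BLOCK SWEEP ≤ TWO RANDOM-SCAN STEPS, for kernels (Abel form, unconditional).**
`κ₁, κ₂` `π`-reversible Markov kernels, `R = mixtureKernel t κ₁ κ₂` with `(t : ℝ) = ½`; for every
bounded measurable `g` and `0 ≤ r < 1`:
`Σ_k autocov (κ₂ ∘ₖ κ₁) π g k rᵏ ≤ Σ_k autocov (R ∘ₖ R) π g k rᵏ`. -/
theorem abelSum_autocov_orderedSweep_le_randomScanTwo (h₁ : Kernel.IsReversible κ₁ π)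
    (h₂ : Kernel.IsReversible κ₂ π) (t : unitInterval) (ht : (t : ℝ) = 1 / 2) {g : Ω → ℝ}
    (hg : Measurable g) {Bg : ℝ} (hBg : ∀ x, |g x| ≤ Bg) {r : ℝ} (hr0 : 0 ≤ r) (hr1 : r < 1) :
    ∑' k, autocov (κ₂ ∘ₖ κ₁) π g k * r ^ k
      ≤ ∑' k, autocov (mixtureKernel t κ₁ κ₂ ∘ₖ mixtureKernel t κ₁ κ₂) π g k * r ^ k := by
  have h := RevOp.abelSum_ordered_le_randomScanTwo (μ := π) (w := fun _ : Ω => (1 : ℝ))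
    (A := fun f : Ω → ℝ => Measurable f ∧ ∃ B, ∀ x, |f x| ≤ B) (P₁ := kop κ₁) (P₂ := kop κ₂)
    (K := kop (κ₂ ∘ₖ κ₁)) (R := kop (mixtureKernel t κ₁ κ₂))
    (T := kop (mixtureKernel t κ₁ κ₂ ∘ₖ mixtureKernel t κ₁ κ₂))
    (fun _ => zero_le_one) bddMeas_integrable_mul bddMeas_add_mul (kop_bddMeas κ₁) (kop_bddMeas κ₂)
    (kop_lin_bddMeas κ₁) (kop_lin_bddMeas κ₂) (kop_symm_bddMeas κ₁ h₁) (kop_symm_bddMeas κ₂ h₂)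
    (kop_contr_bddMeas κ₁ h₁.invariant) (kop_contr_bddMeas κ₂ h₂.invariant)
    (kop_mixture_half_bddMeas t ht) kop_comp_bddMeas kop_comp_bddMeas
    ⟨hg, Bg, hBg⟩ hr0 hr1
  rwa [tsum_integral_mul_iterate_kop_mul_one, tsum_integral_mul_iterate_kop_mul_one] at h

/-- **`τ_int(g; κ₂ ∘ₖ κ₁) ≤ τ_int(g; R ∘ₖ R)`** under summability of both normalised series,
`∫ g² dπ > 0` (two-block deterministic scan against random scan at equal cost, `Scoring.tauInt`). -/
theorem tauInt_orderedSweep_le_randomScanTwo (h₁ : Kernel.IsReversible κ₁ π)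
    (h₂ : Kernel.IsReversible κ₂ π) (t : unitInterval) (ht : (t : ℝ) = 1 / 2) {g : Ω → ℝ}
    (hg : Measurable g) {Bg : ℝ} (hBg : ∀ x, |g x| ≤ Bg) (hP : 0 < ∫ x, g x ^ 2 ∂π)
    (hsK : Summable fun n => autocov (κ₂ ∘ₖ κ₁) π g (n + 1) / autocov (κ₂ ∘ₖ κ₁) π g 0)
    (hsT : Summable fun n => autocov (mixtureKernel t κ₁ κ₂ ∘ₖ mixtureKernel t κ₁ κ₂) π g (n + 1)
      / autocov (mixtureKernel t κ₁ κ₂ ∘ₖ mixtureKernel t κ₁ κ₂) π g 0) :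
    tauInt (fun n => autocov (κ₂ ∘ₖ κ₁) π g n / autocov (κ₂ ∘ₖ κ₁) π g 0)
      ≤ tauInt (fun n => autocov (mixtureKernel t κ₁ κ₂ ∘ₖ mixtureKernel t κ₁ κ₂) π g n
          / autocov (mixtureKernel t κ₁ κ₂ ∘ₖ mixtureKernel t κ₁ κ₂) π g 0) := by
  set K := κ₂ ∘ₖ κ₁ with hKdef
  set T := mixtureKernel t κ₁ κ₂ ∘ₖ mixtureKernel t κ₁ κ₂ with hTdef
  have hCK : autocov K π g 0 = ∫ x, g x ^ 2 ∂π := autocov_zero K π g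
  have hCT : autocov T π g 0 = ∫ x, g x ^ 2 ∂π := autocov_zero T π g
  have conv : ∀ (η : Kernel Ω Ω) (n : ℕ),
      (∫ x, g x * (kop η)^[n] g x * (fun _ : Ω => (1 : ℝ)) x ∂π) / ∫ x, g x ^ 2 * (fun _ : Ω => (1 : ℝ)) x ∂π
        = autocov η π g n / ∫ x, g x ^ 2 ∂π := fun η n => by
    rw [integral_mul_iterate_kop_mul_one]; simp only [mul_one]
  have hP' : 0 < ∫ x, g x ^ 2 * (fun _ : Ω => (1 : ℝ)) x ∂π := by simpa only [mul_one] using hP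
  have hsK' : Summable fun n => (∫ x, g x * (kop K)^[n + 1] g x * (fun _ : Ω => (1 : ℝ)) x ∂π)
      / ∫ x, g x ^ 2 * (fun _ : Ω => (1 : ℝ)) x ∂π :=
    (hsK.congr fun n => by rw [hCK]).congr fun n => (conv K (n + 1)).symm
  have hsT' : Summable fun n => (∫ x, g x * (kop T)^[n + 1] g x * (fun _ : Ω => (1 : ℝ)) x ∂π)
      / ∫ x, g x ^ 2 * (fun _ : Ω => (1 : ℝ)) x ∂π :=
    (hsT.congr fun n => by rw [hCT]).congr fun n => (conv T (n + 1)).symm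
  have h := RevOp.tauInt_ordered_le_randomScanTwo (μ := π) (w := fun _ : Ω => (1 : ℝ))
    (A := fun f : Ω → ℝ => Measurable f ∧ ∃ B, ∀ x, |f x| ≤ B) (P₁ := kop κ₁) (P₂ := kop κ₂)
    (K := kop K) (R := kop (mixtureKernel t κ₁ κ₂)) (T := kop T)
    (fun _ => zero_le_one) bddMeas_integrable_mul bddMeas_add_mul (kop_bddMeas κ₁) (kop_bddMeas κ₂)
    (kop_lin_bddMeas κ₁) (kop_lin_bddMeas κ₂) (kop_symm_bddMeas κ₁ h₁) (kop_symm_bddMeas κ₂ h₂)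
    (kop_contr_bddMeas κ₁ h₁.invariant) (kop_contr_bddMeas κ₂ h₂.invariant)
    (kop_mixture_half_bddMeas t ht) kop_comp_bddMeas kop_comp_bddMeas
    ⟨hg, Bg, hBg⟩ hP' hsK' hsT'
  have e1 : (fun n => (∫ x, g x * (kop K)^[n] g x * (fun _ : Ω => (1 : ℝ)) x ∂π)
      / ∫ x, g x ^ 2 * (fun _ : Ω => (1 : ℝ)) x ∂π) = fun n => autocov K π g n / autocov K π g 0 := by
    funext n; rw [conv, hCK]
  have e2 : (fun n => (∫ x, g x * (kop T)^[n] g x * (fun _ : Ω => (1 : ℝ)) x ∂π)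
      / ∫ x, g x ^ 2 * (fun _ : Ω => (1 : ℝ)) x ∂π) = fun n => autocov T π g n / autocov T π g 0 := by
    funext n; rw [conv, hCT]
  rwa [e1, e2] at h

/-- **ORDERED TWO-BLOCK SWEEP ≤ RANDOM-ORDER SWEEP, for kernels (Abel form, unconditional)**: with
`S = mixtureKernel t (κ₂ ∘ₖ κ₁) (κ₁ ∘ₖ κ₂)`, `(t : ℝ) = ½`:
`Σ_k autocov (κ₂ ∘ₖ κ₁) π g k rᵏ ≤ Σ_k autocov S π g k rᵏ`. -/
theorem abelSum_autocov_orderedSweep_le_randomOrder (h₁ : Kernel.IsReversible κ₁ π)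
    (h₂ : Kernel.IsReversible κ₂ π) (t : unitInterval) (ht : (t : ℝ) = 1 / 2) {g : Ω → ℝ}
    (hg : Measurable g) {Bg : ℝ} (hBg : ∀ x, |g x| ≤ Bg) {r : ℝ} (hr0 : 0 ≤ r) (hr1 : r < 1) :
    ∑' k, autocov (κ₂ ∘ₖ κ₁) π g k * r ^ k
      ≤ ∑' k, autocov (mixtureKernel t (κ₂ ∘ₖ κ₁) (κ₁ ∘ₖ κ₂)) π g k * r ^ k := by
  have hS : ∀ ⦃f : Ω → ℝ⦄, (Measurable f ∧ ∃ B, ∀ x, |f x| ≤ B) →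
      ∀ x, kop (mixtureKernel t (κ₂ ∘ₖ κ₁) (κ₁ ∘ₖ κ₂)) f x
        = (kop (κ₂ ∘ₖ κ₁) f x + kop (κ₁ ∘ₖ κ₂) f x) / 2 := by
    rintro f ⟨hf, B, hB⟩ x
    rw [kop_mixtureKernel t hf hB x, ht]
    ring
  have h := RevOp.abelSum_ordered_le_randomOrder (μ := π) (w := fun _ : Ω => (1 : ℝ))
    (A := fun f : Ω → ℝ => Measurable f ∧ ∃ B, ∀ x, |f x| ≤ B) (P₁ := kop κ₁) (P₂ := kop κ₂)
    (K := kop (κ₂ ∘ₖ κ₁)) (K' := kop (κ₁ ∘ₖ κ₂)) (S := kop (mixtureKernel t (κ₂ ∘ₖ κ₁) (κ₁ ∘ₖ κ₂)))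
    (fun _ => zero_le_one) bddMeas_integrable_mul bddMeas_add_mul (kop_bddMeas κ₁) (kop_bddMeas κ₂)
    (kop_lin_bddMeas κ₁) (kop_lin_bddMeas κ₂) (kop_symm_bddMeas κ₁ h₁) (kop_symm_bddMeas κ₂ h₂)
    (kop_contr_bddMeas κ₁ h₁.invariant) (kop_contr_bddMeas κ₂ h₂.invariant) kop_comp_bddMeas
    kop_comp_bddMeas hS ⟨hg, Bg, hBg⟩ hr0 hr1
  rwa [tsum_integral_mul_iterate_kop_mul_one, tsum_integral_mul_iterate_kop_mul_one] at h

end TwoBlocks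

end Summit.Ventures.LatticeQCDFlow.Scoring
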